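import Mathlib
import Literature.MathematicalPhysics.QuantumFieldTheory.Balaban1983to89.B15Ineq147LevelGap
import Literature.MathematicalPhysics.QuantumFieldTheory.Balaban1983to89.B14Eq213MaximalDomains

/-!
# `Balaban1983to89.B15Ineq147Admissible` — [Balaban1989LargeFieldI] (1.47) p. 186: the geometric input
# «d(y, Ω^c_{j+1}∖Z″_{j+1}) ≥ (M/M₁)(j − i)» holds for EVERY [III] (2.13)-admissible sequence of domains on the ℤᵈ cube
# carrier — the last geometric hypothesis (`LayerSepZd`) of `B15Ineq147LevelGap` §4 DISCHARGED from r11's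
# `B14.Eq213MaximalDomains` (KNITTING; instance: the maximal sequence `maxDom`)

statement-level skeleton of published theorems with citation tags; proofs where landed; nothing here is a claim about
the Yang–Mills mass gap.

CITATION HEADER (lean-in-tree rule 2026-08-18).  T. Bałaban, *Large field renormalization. I. The basic step of the 𝐑
operation*, Commun. Math. Phys. **122**, 175–202 (1989), doi:10.1007/BF01257412, bib `Balaban1989LargeFieldI` (cell paper
B15 = [IV]; PDF held `paper:balaban1989-cmp122-large-field-i`; p. 179 = PDF 5, p. 186 = PDF 12).  "[III]" = T. Bałaban,
*Convergent renormalization expansions for lattice gauge theories*, Commun. Math. Phys. **119**, 243–285 (1988),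
doi:10.1007/BF01217741, bib `Balaban1988Convergent` (cell paper B14; p. 256 = PDF 14, OCR `p0014.txt`).  "[3]" = T. Bałaban,
*Propagators and renormalization transformations for lattice gauge theories. II*, Commun. Math. Phys. **96**, 223–250 (1984),
bib `Balaban1984PropagatorsII` (cell paper B6; (2.46) p. 231).
WHAT IS REPRODUCED: SKELETON row `B15.Eq1.47` (owner r12), geometric input; cross-reference row `B14.Eq2.13` (owner r11).
Unit `lit-balaban-p29` gen 8 (Phase-2 free target, G.5-34(d)), HOME `run/shared/lean/pub/lit-balaban/`.  KNITTING — used BY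
NAME, nothing restated: p29 g8 `B15Ineq147LevelGap.{toR, cube, CubeSite, zoneC, bondC, LayerSepZd, levelGap_cube,
walk_length_ge_cube}` (p299858), r11 g4 `B14.Eq213MaximalDomains.{side, side_pos, maxDom, dist_maxDom}` (p248052),
`B14DomainGeom.Within` (r11), `B6Geometry.LevelGap` (pv08), `B15.PrelimIntegrations.Ineq147`/`ineq147_of_dist` (r12).

THE PRINTED TEXT.  [IV] p. 179 [PDF 5]: *"complete these two sets to a sequence Z″_k, Z″_{k−1}, …, Z″_{k−N₀+1} in such a way
that the complements of these sets form an admissible sequence of domains based on partitions into M-cubes in the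
corresponding scales. Thus Z″_k, Z″_k∖Z″_{k−1} are unions of M-cubes of the lattice T_η, and Z″_k, Z″_{k−1} are separated by
one layer of M-cubes. Similarly … L^{−1}M-cubes, and so on."*  [IV] p. 186 [PDF 12]: *"Thus, by the definition of the
domains Z″_i, we obtain exp(−δd(y, Ω^c_{j+1}∖Z″_{j+1})) ≦ exp(−δ(M/M₁)(j − i)) for y ∈ Γ″_i, i < j. (1.47)"*, the scaled
distance being *"defined in terms of M₁-cubes on corresponding scales"*.  [III] p. 256 [PDF 14], the notion of an admissible
(maximal) sequence: *"a sequence of maximal domains Ω = Ω₀ ⊃ Ω₁ ⊃ … ⊃ Ω_j such that Ω_n is a union of LⁿξM₁-cubes, and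
dist(Ω_n, Ω^c_{n−1}) ≧ LⁿξM₁, n = 1, …, j (the distance is for the lattice T_ξ)"* — typed CONCRETELY by r11 as `maxDom` with
the lattice reading of the distance condition `dist_maxDom : x ∈ Ω_{n+1} → Within (s_{n+1} − 1) x y → y ∈ Ω_n`
(`s_n = side L M n = Lⁿ·M` lattice units) and the maximality `seq_subset_maxDom` over all sequences with that property.

THE DICTIONARY (ours = `B15Ineq147LevelGap`'s + r11's).  Units: the finest lattice of the tower is `ℤᵈ` (η = 1), scales are
counted from the bottom (`n = 0, 1, …`), the partition cubes of scale `n` have side `M·Lⁿ` (the letter `M₁` of [III] (2.13)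
is the letter `M` of [IV] p. 179 here) and the bond cubes side `M₁·Lⁿ`, `M₁ ∣ M`.  An admissible sequence is a family
`D : ℕ → Set ℤᵈ` with r11's separation property `hdist : x ∈ D (n+1) → Within (M·L^{n+1} − 1) x y → y ∈ D n` (which
implies `D (n+1) ⊆ D n`); [IV]'s large-field regions are the complements `Z″_n := (D n)ᶜ` (increasing in `n`), and
`B15Ineq147LevelGap.LayerSepZd Z″ M L` (*"separated by one layer of [M·L^{n+1}]-cubes"*: `a ∈ Z″_n`, `b ∉ Z″_{n+1}` ⇒
sup-distance `≥ M·L^{n+1}`) is exactly `hdist` read contrapositively (`layerSepZd_of_admissible`).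

WHAT THIS FILE PROVES (kernel-checked, zero `sorry`; §§1–3 theorems only, §4 (v1.1) adds two definitions with bodies; no named
fact; axioms standard).
§1 (private `dist_toR_ge_of_not_within`: lattice points not `Within r` are at sup-distance `≥ r + 1` in `ℝᵈ`);
   `subset_of_admissible`/`monotone_compl_of_admissible` (nesting); **`layerSepZd_of_admissible`**.
§2 **`levelGap_admissible`** — for every admissible `D`, the zoned graph of bond cubes of `B15Ineq147LevelGap` §4 built on
   `Z″ = Dᶜ` has the [3] level gap `M/M₁`, with NO geometric hypothesis left (only `0 < M₁`, `M₁ ∣ M`, `2 ≤ L`);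
   **`walk_length_ge_admissible`** — the walk form of the (1.47) input: every admissible contour from a bond cube of scale
   `≤ i` to a bond cube meeting `D (j+1) = Ω″_{j+1}` has at least `(M/M₁)(j − i)` bonds; **`ineq147_walk_admissible`** — (1.47)
   itself (`B15.PrelimIntegrations.Ineq147 δ |Γ| M M₁ (j − i)`, `δ ≥ 0`) for the length `|Γ|` of any such contour.
§3 the instance r11 CONSTRUCTED: `admissible_maxDom` (= `dist_maxDom`), `layerSepZd_maxDom`, `levelGap_maxDom`,
   `walk_length_ge_maxDom`, `ineq147_walk_maxDom` — for the maximal sequence of [III] (2.13) inside any `Ω ⊆ ℤᵈ`.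
§4 (v1.1; two definitions WITH BODIES, `bondN`, `Touching`) the NEIGHBOUR-SCALE bond model — print's contours read as chains of
   TOUCHING cubes: `bondN` (distinct cube-sites of scales differing by `≤ 1`, corners within the COARSER side), `bondN_adj`,
   `bondScale_nbr` (bond scale `M₁L^{n+1}`, i.e. `e = 1` of `B15Ineq147LevelGap` §5), `Touching`, `dist_posC_le_of_touching`,
   `zone_le_succ_of_touching` (the layers force touching cubes onto consecutive scales), **`adj_nbr_of_touching`** (every pair
   of distinct touching cubes is a bond of `bondN`, so every contour of touching cubes is a walk in `bondN`),
   **`directGap_nbr`** (`DirectGap (M/M₁)` by the reading-independent route `directGap_Z`, `e = 1`), **`walk_length_ge_nbr`**,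
   `walk_length_ge_nbr_admissible`, `ineq147_walk_nbr_admissible`, `walk_length_ge_nbr_maxDom` — the (1.47) input for contours
   of touching `M₁`-cubes on corresponding scales, for every admissible sequence, no geometric hypothesis left.
HONEST SCOPE.  Nothing analytic.  Which admissible completion [IV] p. 179 takes between its two given end sets is not fixed in
print (*"in such a way that"*); §2 covers every one, §3 the maximal one of [III] p. 256.  The passage from the ℤᵈ walk form
to r12's abstract `hD`/`hgeo` hypotheses over a `B6.Geometry` is `B15Ineq147LevelGap.dist_ge_147`/`hD_147` (abstract contour
systems) — the cube graph `bondC` is not registered as a `B6Geometry.ContourSystem` here.  The two readings of *"M₁-cubes on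
corresponding scales"* are discussed in `B15Ineq147LevelGap` (§5 `DirectGap`); §§2–3 use its §4 (`LevelGap`) route (corner
bonds within the FINER side, `2 ≤ L` gives the strict [3] (2.2) threshold), §4 (v1.1) its §5 route for the touching-cube
reading.  NOT summit progress.
-/

namespace Literature.MathematicalPhysics.QuantumFieldTheory.Balaban1983to89.B15Ineq147Admissible

open Literature.MathematicalPhysics.QuantumFieldTheory.Balaban1983to89
open B6Geometry B6LevelGapMetric B15Ineq147LevelGap B14DomainGeom B14.Eq213MaximalDomains

variable {d : ℕ}

/-! ## §1. Admissibility ⇒ nesting and the one-layer separation `LayerSepZd` -/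

/-- Lattice points that are not `Within r` of each other are at sup-distance `≥ r + 1` as points of `ℝᵈ`. [folklore] -/
private theorem dist_toR_ge_of_not_within {r : ℤ} {a b : Fin d → ℤ} (h : ¬ Within r a b) :
    (r : ℝ) + 1 ≤ dist (toR a) (toR b) := by
  unfold Within at h
  push Not at h
  obtain ⟨i, hi⟩ := h
  have h1 : r + 1 ≤ |a i - b i| := Int.add_one_le_iff.mpr hi
  have h2 : ((r + 1 : ℤ) : ℝ) ≤ ((|a i - b i| : ℤ) : ℝ) := by exact_mod_cast h1
  have h3 : dist (toR a i) (toR b i) = ((|a i - b i| : ℤ) : ℝ) := by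
    rw [Real.dist_eq]
    push_cast
    rfl
  calc (r : ℝ) + 1 = ((r + 1 : ℤ) : ℝ) := by push_cast; ring
    _ ≤ ((|a i - b i| : ℤ) : ℝ) := h2
    _ = dist (toR a i) (toR b i) := h3.symm
    _ ≤ dist (toR a) (toR b) := dist_le_pi_dist (toR a) (toR b) i

/-- *"Ω₀ ⊃ Ω₁ ⊃ … ⊃ Ω_j"*: the separation property of an admissible sequence implies nesting `D (n+1) ⊆ D n` (a point is
`Within (s − 1)` of itself, `s ≥ 1`). [cite: Balaban1988Convergent, (2.13) p.256] -/
theorem subset_of_admissible {L M : ℕ} (hL : 1 ≤ L) (hM : 1 ≤ M) {D : ℕ → Set (Fin d → ℤ)}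
    (hdist : ∀ n, ∀ x ∈ D (n + 1), ∀ y, Within ((side L M (n + 1) : ℤ) - 1) x y → y ∈ D n) (n : ℕ) :
    D (n + 1) ⊆ D n := fun x hx =>
  hdist n x hx x (Within.refl (by have := side_pos hL hM (n + 1); omega) x)

/-- Hence the large-field regions `Z″_n := (D n)ᶜ` increase with the scale: `Z″_n ⊆ Z″_{n+1}` ([IV] p. 179 "`Z″_k ⊃ Z″_{k−1} ⊃ …`").
[cite: Balaban1989LargeFieldI, (1.11) p.179; Balaban1988Convergent, (2.13) p.256] -/
theorem monotone_compl_of_admissible {L M : ℕ} (hL : 1 ≤ L) (hM : 1 ≤ M) {D : ℕ → Set (Fin d → ℤ)}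
    (hdist : ∀ n, ∀ x ∈ D (n + 1), ∀ y, Within ((side L M (n + 1) : ℤ) - 1) x y → y ∈ D n) :
    Monotone (fun n => (D n)ᶜ) :=
  monotone_nat_of_le_succ fun n => Set.compl_subset_compl.mpr (subset_of_admissible hL hM hdist n)

/-- **The one-layer separation of [IV] p. 179 from [III] (2.13)-admissibility**: for an admissible sequence `D` (partition
cubes of side `M·Lⁿ`), the complements `Z″_n = (D n)ᶜ` satisfy `LayerSepZd Z″ M L` — a point of `Z″_n` and a point of
`D (n+1) = (Z″_{n+1})ᶜ` are at sup-distance `≥ M·L^{n+1}` (*"separated by one layer of [M·L^{n+1}]-cubes"*).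
[cite: Balaban1989LargeFieldI, p.179; Balaban1988Convergent, (2.13) p.256] -/
theorem layerSepZd_of_admissible {L M : ℕ} {D : ℕ → Set (Fin d → ℤ)}
    (hdist : ∀ n, ∀ x ∈ D (n + 1), ∀ y, Within ((side L M (n + 1) : ℤ) - 1) x y → y ∈ D n) :
    LayerSepZd (fun n => (D n)ᶜ) M L := by
  intro n a b ha hb
  have hb' : b ∈ D (n + 1) := by
    by_contra h
    exact hb h
  have hw : ¬ Within ((side L M (n + 1) : ℤ) - 1) b a := fun hw => ha (hdist n b hb' a hw)
  have h := dist_toR_ge_of_not_within hw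
  rw [dist_comm] at h
  have hside : (((side L M (n + 1) : ℤ) - 1 : ℤ) : ℝ) + 1 = (M : ℝ) * (L : ℝ) ^ (n + 1) := by
    unfold side; push_cast; ring
  show (M : ℝ) * (L : ℝ) ^ (n + 1) ≤ dist (toR a) (toR b)
  rw [← hside]
  exact h

/-! ## §2. The (1.47) input for every admissible sequence: level gap and walk length, no geometric hypothesis left -/

/-- **[3] level gap `M/M₁` for every [III]-admissible sequence** on the ℤᵈ bond-cube graph of `B15Ineq147LevelGap` §4
(bond cubes of side `M₁Lⁿ` inside the layers `Z″_{n+1}∖Z″_n`, `Z″ = Dᶜ`): `levelGap_cube` with its hypotheses `Monotone Z″`,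
`LayerSepZd Z″ M L` DISCHARGED. [cite: Balaban1989LargeFieldI, (1.47) p.186, p.179; Balaban1988Convergent, (2.13) p.256;
Balaban1984PropagatorsII, (2.57) p.233] -/
theorem levelGap_admissible {L M M₁ : ℕ} {D : ℕ → Set (Fin d → ℤ)}
    (hdist : ∀ n, ∀ x ∈ D (n + 1), ∀ y, Within ((side L M (n + 1) : ℤ) - 1) x y → y ∈ D n)
    (hM₁ : 0 < M₁) (hdvd : M₁ ∣ M) (hM : 0 < M) (hL : 2 ≤ L) :
    LevelGap (bondC M₁ L (fun n => (D n)ᶜ)) zoneC (M / M₁) :=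
  levelGap_cube (monotone_compl_of_admissible (by omega) hM hdist) (layerSepZd_of_admissible hdist) hM hM₁ hdvd hL

/-- **The (1.47) input, walk form, for every [III]-admissible sequence**: an admissible contour (walk in the bond-cube graph)
from a bond cube of scale `≤ i` (a point of `Γ″_{i′}`, `i′ ≤ i`) to a bond cube containing a point of `D (j+1) = Ω″_{j+1}`
(in particular of `Ω^c_{j+1}∖Z″_{j+1}`) has at least `(M/M₁)·(j − i)` bonds — *"by the definition of the domains Z″_i"*.
[cite: Balaban1989LargeFieldI, (1.47) p.186, p.179; Balaban1988Convergent, (2.13) p.256; Balaban1984PropagatorsII, (2.46) p.231] -/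
theorem walk_length_ge_admissible {L M M₁ : ℕ} {D : ℕ → Set (Fin d → ℤ)}
    (hdist : ∀ n, ∀ x ∈ D (n + 1), ∀ y, Within ((side L M (n + 1) : ℤ) - 1) x y → y ∈ D n)
    (hM₁ : 0 < M₁) (hdvd : M₁ ∣ M) (hM : 0 < M) (hL : 2 ≤ L) {i j : ℕ}
    {s t : CubeSite M₁ L (fun n => (D n)ᶜ)} (p : (bondC M₁ L (fun n => (D n)ᶜ)).Walk s t) (hs : zoneC s ≤ i)
    (ht : ∃ x ∈ cube M₁ L t.1.1 t.1.2, x ∈ D (j + 1)) : M / M₁ * (j - i) ≤ p.length := by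
  refine walk_length_ge_cube (monotone_compl_of_admissible (by omega) hM hdist) (layerSepZd_of_admissible hdist)
    hM hM₁ hdvd hL p hs ?_
  rintro hsub
  obtain ⟨x, hx, hxD⟩ := ht
  exact hsub hx hxD

/-- **(1.47) for every [III]-admissible sequence**, in r12's typed shape `B15.PrelimIntegrations.Ineq147 δ d M M₁ (j − i)`:
with `d` the length of any admissible contour as in `walk_length_ge_admissible` and `δ ≥ 0`,
`exp(−δd) ≤ exp(−δ(M/M₁)(j − i))`. [cite: Balaban1989LargeFieldI, (1.47) p.186] -/
theorem ineq147_walk_admissible {L M M₁ : ℕ} {D : ℕ → Set (Fin d → ℤ)}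
    (hdist : ∀ n, ∀ x ∈ D (n + 1), ∀ y, Within ((side L M (n + 1) : ℤ) - 1) x y → y ∈ D n)
    (hM₁ : 0 < M₁) (hdvd : M₁ ∣ M) (hM : 0 < M) (hL : 2 ≤ L) {i j : ℕ}
    {s t : CubeSite M₁ L (fun n => (D n)ᶜ)} (p : (bondC M₁ L (fun n => (D n)ᶜ)).Walk s t) (hs : zoneC s ≤ i)
    (ht : ∃ x ∈ cube M₁ L t.1.1 t.1.2, x ∈ D (j + 1)) {δ : ℝ} (hδ : 0 ≤ δ) :
    B15.PrelimIntegrations.Ineq147 δ (p.length : ℝ) M M₁ ((j - i : ℕ) : ℝ) := by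
  have h := walk_length_ge_admissible hdist hM₁ hdvd hM hL p hs ht
  have hM₁' : (0 : ℝ) < M₁ := by exact_mod_cast hM₁
  have hcast : ((M / M₁ : ℕ) : ℝ) = (M : ℝ) / M₁ := Nat.cast_div hdvd hM₁'.ne'
  have h' : (M : ℝ) / M₁ * ((j - i : ℕ) : ℝ) ≤ (p.length : ℝ) := by
    rw [← hcast]
    exact_mod_cast h
  exact B15.PrelimIntegrations.ineq147_of_dist (by nlinarith [h', hδ])

/-! ## §3. The instance [III] constructs: the maximal sequence `maxDom` -/

/-- r11's maximal sequence `Ω_n = maxDom L M Ω n` IS admissible in the above sense (its `dist_maxDom`).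
[cite: Balaban1988Convergent, (2.13) p.256] -/
theorem admissible_maxDom (L M : ℕ) (Ω : Set (Fin d → ℤ)) :
    ∀ n, ∀ x ∈ maxDom L M Ω (n + 1), ∀ y, Within ((side L M (n + 1) : ℤ) - 1) x y → y ∈ maxDom L M Ω n :=
  fun n _ hx _ hy => dist_maxDom L M Ω n hx hy

/-- The one-layer separation of [IV] p. 179 for the complements of the maximal sequence. [cite: Balaban1989LargeFieldI, p.179;
Balaban1988Convergent, (2.13) p.256] -/
theorem layerSepZd_maxDom (L M : ℕ) (Ω : Set (Fin d → ℤ)) : LayerSepZd (fun n => (maxDom L M Ω n)ᶜ) M L :=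
  layerSepZd_of_admissible (admissible_maxDom L M Ω)

/-- The [3] level gap `M/M₁` for the maximal sequence inside any `Ω ⊆ ℤᵈ`. [cite: Balaban1989LargeFieldI, (1.47) p.186;
Balaban1988Convergent, (2.13) p.256; Balaban1984PropagatorsII, (2.57) p.233] -/
theorem levelGap_maxDom {L M M₁ : ℕ} (Ω : Set (Fin d → ℤ)) (hM₁ : 0 < M₁) (hdvd : M₁ ∣ M) (hM : 0 < M) (hL : 2 ≤ L) :
    LevelGap (bondC M₁ L (fun n => (maxDom L M Ω n)ᶜ)) zoneC (M / M₁) :=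
  levelGap_admissible (admissible_maxDom L M Ω) hM₁ hdvd hM hL

/-- The (1.47) input, walk form, for the maximal sequence: at least `(M/M₁)(j − i)` bonds from a scale-`≤ i` bond cube to a
bond cube meeting `Ω_{j+1}`. [cite: Balaban1989LargeFieldI, (1.47) p.186; Balaban1988Convergent, (2.13) p.256] -/
theorem walk_length_ge_maxDom {L M M₁ : ℕ} (Ω : Set (Fin d → ℤ)) (hM₁ : 0 < M₁) (hdvd : M₁ ∣ M) (hM : 0 < M)
    (hL : 2 ≤ L) {i j : ℕ} {s t : CubeSite M₁ L (fun n => (maxDom L M Ω n)ᶜ)}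
    (p : (bondC M₁ L (fun n => (maxDom L M Ω n)ᶜ)).Walk s t) (hs : zoneC s ≤ i)
    (ht : ∃ x ∈ cube M₁ L t.1.1 t.1.2, x ∈ maxDom L M Ω (j + 1)) : M / M₁ * (j - i) ≤ p.length :=
  walk_length_ge_admissible (admissible_maxDom L M Ω) hM₁ hdvd hM hL p hs ht

/-- (1.47) for the maximal sequence, r12's typed shape. [cite: Balaban1989LargeFieldI, (1.47) p.186] -/
theorem ineq147_walk_maxDom {L M M₁ : ℕ} (Ω : Set (Fin d → ℤ)) (hM₁ : 0 < M₁) (hdvd : M₁ ∣ M) (hM : 0 < M)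
    (hL : 2 ≤ L) {i j : ℕ} {s t : CubeSite M₁ L (fun n => (maxDom L M Ω n)ᶜ)}
    (p : (bondC M₁ L (fun n => (maxDom L M Ω n)ᶜ)).Walk s t) (hs : zoneC s ≤ i)
    (ht : ∃ x ∈ cube M₁ L t.1.1 t.1.2, x ∈ maxDom L M Ω (j + 1)) {δ : ℝ} (hδ : 0 ≤ δ) :
    B15.PrelimIntegrations.Ineq147 δ (p.length : ℝ) M M₁ ((j - i : ℕ) : ℝ) :=
  ineq147_walk_admissible (admissible_maxDom L M Ω) hM₁ hdvd hM hL p hs ht hδ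

/-! ## §4 (v1.1). The NEIGHBOUR-SCALE bond model: contours of touching cubes on consecutive scales

The bond graph `B15Ineq147LevelGap.bondC` (corners within the FINER side) is sparse across scales.  Print's admissible
contours ([3] p. 231, [IV] p. 186 *"M₁-cubes on corresponding scales"*) are naturally chains of TOUCHING cubes, a cube of
scale `n` touching cubes of scale `n` or `n ± 1` only (the layers separate the scales).  The graph `bondN` below contains
every such pair (`adj_nbr_of_touching`): two cube-sites of scales differing by at most one whose corners are within the
COARSER side `M₁·L^{max}` in the sup-metric.  Its bonds have length `≤ M₁·L^{n+1}` for `n` the finer scale, i.e. the bond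
scale of `B15Ineq147LevelGap` §5 with `e = 1`, so the READING-INDEPENDENT route `directGap_Z` (v1.1 of that file) applies:
`DirectGap (M/M₁)` and the walk form of the (1.47) input for every admissible sequence, hence for every contour of touching
cubes. -/

section NeighbourScale

variable {M₁ L : ℕ} {Z : ℕ → Set (Fin d → ℤ)}

/-- **Neighbour-scale bonds**: distinct cube-sites `s`, `t` with `|scale s − scale t| ≤ 1` and corners within the coarser side
`M₁·L^{max(scale s, scale t)}` (sup-metric) — a superset of "the two lattice cubes touch" (`adj_nbr_of_touching`).
[cite: Balaban1989LargeFieldI, (1.47) p.186; Balaban1984PropagatorsII, (2.46) p.231] -/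
def bondN (M₁ L : ℕ) (Z : ℕ → Set (Fin d → ℤ)) : SimpleGraph (CubeSite M₁ L Z) :=
  SimpleGraph.fromRel fun s t =>
    zoneC t ≤ zoneC s + 1 ∧ zoneC s ≤ zoneC t + 1 ∧ dist (posC s) (posC t) ≤ scaleC M₁ L (max (zoneC s) (zoneC t))

/-- Unfolding of the adjacency of `bondN`. [cite: Balaban1984PropagatorsII, (2.46) p.231] -/
theorem bondN_adj {s t : CubeSite M₁ L Z} : (bondN M₁ L Z).Adj s t ↔ s ≠ t ∧ zoneC t ≤ zoneC s + 1 ∧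
    zoneC s ≤ zoneC t + 1 ∧ dist (posC s) (posC t) ≤ scaleC M₁ L (max (zoneC s) (zoneC t)) := by
  rw [bondN, SimpleGraph.fromRel_adj]
  constructor
  · rintro ⟨hne, h | h⟩
    · exact ⟨hne, h⟩
    · rw [dist_comm, max_comm] at h
      exact ⟨hne, h.2.1, h.1, h.2.2⟩
  · rintro ⟨hne, h⟩
    exact ⟨hne, Or.inl h⟩

/-- `bondN` has the bond scale `M₁·L^{n+1}` (`n` = the finer scale of the bond; `e = 1` in `B15Ineq147LevelGap` §5).
[cite: Balaban1984PropagatorsII, p.231; Balaban1989LargeFieldI, p.186] -/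
theorem bondScale_nbr (hL : 1 ≤ L) : BondScale (bondN M₁ L Z) zoneC posC (fun n => (M₁ : ℝ) * (L : ℝ) ^ (n + 1) * 1) := by
  intro s t h
  obtain ⟨-, h1, h2, hd⟩ := bondN_adj.mp h
  refine hd.trans ?_
  show (M₁ : ℝ) * (L : ℝ) ^ (max (zoneC s) (zoneC t)) * 1 ≤ (M₁ : ℝ) * (L : ℝ) ^ (min (zoneC s) (zoneC t) + 1) * 1
  have hL' : (1 : ℝ) ≤ L := by exact_mod_cast hL
  have hmax : max (zoneC s) (zoneC t) ≤ min (zoneC s) (zoneC t) + 1 := by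
    rcases le_total (zoneC s) (zoneC t) with hst | hts
    · rw [max_eq_right hst, min_eq_left hst]; exact h1
    · rw [max_eq_left hts, min_eq_right hts]; exact h2
  exact mul_le_mul_of_nonneg_right (mul_le_mul_of_nonneg_left (pow_le_pow_right₀ hL' hmax) (Nat.cast_nonneg _))
    zero_le_one

/-- Two lattice cubes TOUCH: some lattice point of one is within sup-distance `1` of some lattice point of the other.
[cite: Balaban1984PropagatorsII, (2.46) p.231] -/
def Touching (s t : CubeSite M₁ L Z) : Prop :=
  ∃ p ∈ cube M₁ L s.1.1 s.1.2, ∃ q ∈ cube M₁ L t.1.1 t.1.2, dist (toR p) (toR q) ≤ 1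

/-- A point of a cube lies between its corner and corner + side − 1, coordinatewise (real form). [folklore] -/
private theorem corner_le_of_mem {n : ℕ} {c p : Fin d → ℤ} (hp : p ∈ cube M₁ L n c) (μ : Fin d) :
    ((corner M₁ L n c μ : ℤ) : ℝ) ≤ (p μ : ℝ) ∧ (p μ : ℝ) + 1 ≤ (corner M₁ L n c μ : ℝ) + ((M₁ * L ^ n : ℕ) : ℝ) := by
  have h := hp μ
  have h2 : p μ + 1 ≤ ((M₁ * L ^ n : ℕ) : ℤ) * c μ + ((M₁ * L ^ n : ℕ) : ℤ) := by linarith [h.2]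
  unfold corner
  exact ⟨by exact_mod_cast h.1, by exact_mod_cast h2⟩

/-- One coordinate of the sup-distance of lattice points. [folklore] -/
private theorem abs_sub_le_dist_toR (p q : Fin d → ℤ) (μ : Fin d) : |(p μ : ℝ) - (q μ : ℝ)| ≤ dist (toR p) (toR q) := by
  have h := dist_le_pi_dist (toR p) (toR q) μ
  rwa [Real.dist_eq] at h

/-- The side of a scale-`n` cube is at most the bond scale of any scale `m ≥ n` (`L ≥ 1`). [folklore] -/
private theorem side_le_scaleC (hL : 1 ≤ L) {n m : ℕ} (hnm : n ≤ m) : ((M₁ * L ^ n : ℕ) : ℝ) ≤ scaleC M₁ L m := by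
  unfold scaleC
  push_cast
  rw [mul_one]
  have hL' : (1 : ℝ) ≤ L := by exact_mod_cast hL
  exact mul_le_mul_of_nonneg_left (pow_le_pow_right₀ hL' hnm) (Nat.cast_nonneg _)

/-- **Touching cubes have corners within the coarser side**: `‖corner s − corner t‖_∞ ≤ M₁·L^{max(scale s, scale t)}`
(`L ≥ 1`). [cite: Balaban1984PropagatorsII, (2.46) p.231] -/
theorem dist_posC_le_of_touching (hL : 1 ≤ L) {s t : CubeSite M₁ L Z} (h : Touching s t) :
    dist (posC s) (posC t) ≤ scaleC M₁ L (max (zoneC s) (zoneC t)) := by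
  obtain ⟨p, hp, q, hq, hpq⟩ := h
  have h1 : ((M₁ * L ^ s.1.1 : ℕ) : ℝ) ≤ scaleC M₁ L (max (zoneC s) (zoneC t)) :=
    side_le_scaleC (M₁ := M₁) hL (le_max_left (zoneC s) (zoneC t))
  have h2 : ((M₁ * L ^ t.1.1 : ℕ) : ℝ) ≤ scaleC M₁ L (max (zoneC s) (zoneC t)) :=
    side_le_scaleC (M₁ := M₁) hL (le_max_right (zoneC s) (zoneC t))
  refine (dist_pi_le_iff (by unfold scaleC; positivity)).mpr fun μ => ?_
  rw [Real.dist_eq]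
  show |((corner M₁ L s.1.1 s.1.2 μ : ℤ) : ℝ) - ((corner M₁ L t.1.1 t.1.2 μ : ℤ) : ℝ)| ≤ _
  have hs := corner_le_of_mem hp μ
  have ht := corner_le_of_mem hq μ
  have hμ : |(p μ : ℝ) - (q μ : ℝ)| ≤ 1 := (abs_sub_le_dist_toR p q μ).trans hpq
  rw [abs_le] at hμ ⊢
  constructor <;> linarith [hs.1, hs.2, ht.1, ht.2, hμ.1, hμ.2]

/-- Under the one-layer separation (`L ≥ 2`, `M ≥ 1`), touching cubes lie on scales differing by at most one.
[cite: Balaban1989LargeFieldI, p.179] -/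
theorem zone_le_succ_of_touching {M : ℕ} (hmono : Monotone Z) (hsep : LayerSepZd Z M L) (hM : 1 ≤ M) (hL : 2 ≤ L)
    {s t : CubeSite M₁ L Z} (h : Touching s t) : zoneC t ≤ zoneC s + 1 := by
  by_contra hlt
  have hst : zoneC s + 2 ≤ zoneC t := by omega
  obtain ⟨p, hp, q, hq, hpq⟩ := h
  -- p ∈ Z″_{scale s + 1} ⊆ Z″_{scale t − 1}, q ∉ Z″_{scale t}: separation ≥ M·L^{scale t} ≥ 4 > 1
  have hp0 : p ∈ Z (zoneC s + 1) := (s.2 hp).1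
  have hp' : p ∈ Z (zoneC t - 1) := hmono (show zoneC s + 1 ≤ zoneC t - 1 by omega) hp0
  have hq0 : q ∉ Z (zoneC t) := (t.2 hq).2
  have hq' : q ∉ Z (zoneC t - 1 + 1) := by
    rw [show zoneC t - 1 + 1 = zoneC t by omega]
    exact hq0
  have hge := hsep hp' hq'
  have h4 : (4 : ℝ) ≤ (M : ℝ) * (L : ℝ) ^ (zoneC t - 1 + 1) := by
    have hM' : (1 : ℝ) ≤ M := by exact_mod_cast hM
    have hL' : (2 : ℝ) ≤ L := by exact_mod_cast hL
    have h2 : (2 : ℝ) ^ 2 ≤ (L : ℝ) ^ (zoneC t - 1 + 1) :=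
      (pow_le_pow_left₀ (by norm_num) hL' 2).trans (pow_le_pow_right₀ (by linarith) (by omega))
    nlinarith
  linarith

/-- **Every pair of distinct touching cubes is a bond of `bondN`** (under the one-layer separation, `L ≥ 2`, `M ≥ 1`): a contour
of touching cubes is a walk in `bondN`, so the walk-length bounds below cover print's admissible contours.
[cite: Balaban1989LargeFieldI, (1.47) p.186, p.179; Balaban1984PropagatorsII, (2.46) p.231] -/
theorem adj_nbr_of_touching {M : ℕ} (hmono : Monotone Z) (hsep : LayerSepZd Z M L) (hM : 1 ≤ M) (hL : 2 ≤ L)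
    {s t : CubeSite M₁ L Z} (hne : s ≠ t) (h : Touching s t) : (bondN M₁ L Z).Adj s t := by
  have hsymm : Touching t s := by
    obtain ⟨p, hp, q, hq, hpq⟩ := h
    exact ⟨q, hq, p, hp, by rwa [dist_comm]⟩
  exact bondN_adj.mpr ⟨hne, zone_le_succ_of_touching hmono hsep hM hL h,
    zone_le_succ_of_touching hmono hsep hM hL hsymm, dist_posC_le_of_touching (by omega) h⟩

/-- **`DirectGap (M/M₁)` for the neighbour-scale bond model** from `Monotone Z″` and the one-layer separation — the
reading-independent route of `B15Ineq147LevelGap` §5 with `e = 1`. [cite: Balaban1989LargeFieldI, (1.47) p.186, p.179;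
Balaban1984PropagatorsII, (2.57) p.233] -/
theorem directGap_nbr {M : ℕ} (hmono : Monotone Z) (hsep : LayerSepZd Z M L) (hM₁ : 0 < M₁) (hdvd : M₁ ∣ M)
    (hL : 2 ≤ L) : DirectGap (bondN M₁ L Z) zoneC (M / M₁) := by
  have hM₁' : (0 : ℝ) < M₁ := by exact_mod_cast hM₁
  have hL' : (1 : ℝ) < L := by exact_mod_cast hL
  have hcast : ((M / M₁ : ℕ) : ℝ) = (M : ℝ) / M₁ := Nat.cast_div hdvd hM₁'.ne'
  have hNM : ((M / M₁ : ℕ) : ℝ) * (M₁ : ℝ) = (M : ℝ) := by rw [hcast, div_mul_cancel₀ _ hM₁'.ne']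
  have hlen := bondScale_nbr (M₁ := M₁) (Z := Z) (show 1 ≤ L by omega)
  have hlay := layerSep_cube (M₁ := M₁) hmono hsep hM₁ (show 0 < L by omega)
  exact directGap_Z (e := 1) le_rfl zonesOfZ_cube hlen hlay hM₁' hL' one_pos hNM

/-- **The (1.47) input, walk form, for contours in `bondN`** (in particular for every contour of touching cubes): from a
cube of scale `≤ i` to a cube not inside `Z″_{j+1}`, at least `(M/M₁)(j − i)` bonds. [cite: Balaban1989LargeFieldI, (1.47) p.186] -/
theorem walk_length_ge_nbr {M : ℕ} (hmono : Monotone Z) (hsep : LayerSepZd Z M L) (hM₁ : 0 < M₁) (hdvd : M₁ ∣ M)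
    (hL : 2 ≤ L) {i j : ℕ} {s t : CubeSite M₁ L Z} (p : (bondN M₁ L Z).Walk s t) (hs : zoneC s ≤ i)
    (ht : ¬ cube M₁ L t.1.1 t.1.2 ⊆ Z (j + 1)) : M / M₁ * (j - i) ≤ p.length := by
  refine length_ge_mul_of_directGap (directGap_nbr hmono hsep hM₁ hdvd hL) p hs ?_
  by_contra hlt
  exact ht ((t.2.trans Set.sdiff_subset).trans (hmono (by unfold zoneC at hlt; omega)))

/-- The same for every [III] (2.13)-admissible sequence `D` (`Z″ = Dᶜ`): no geometric hypothesis left.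
[cite: Balaban1989LargeFieldI, (1.47) p.186; Balaban1988Convergent, (2.13) p.256] -/
theorem walk_length_ge_nbr_admissible {M : ℕ} {D : ℕ → Set (Fin d → ℤ)}
    (hdist : ∀ n, ∀ x ∈ D (n + 1), ∀ y, Within ((side L M (n + 1) : ℤ) - 1) x y → y ∈ D n)
    (hM₁ : 0 < M₁) (hdvd : M₁ ∣ M) (hM : 0 < M) (hL : 2 ≤ L) {i j : ℕ}
    {s t : CubeSite M₁ L (fun n => (D n)ᶜ)} (p : (bondN M₁ L (fun n => (D n)ᶜ)).Walk s t) (hs : zoneC s ≤ i)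
    (ht : ∃ x ∈ cube M₁ L t.1.1 t.1.2, x ∈ D (j + 1)) : M / M₁ * (j - i) ≤ p.length := by
  refine walk_length_ge_nbr (monotone_compl_of_admissible (by omega) hM hdist) (layerSepZd_of_admissible hdist)
    hM₁ hdvd hL p hs ?_
  rintro hsub
  obtain ⟨x, hx, hxD⟩ := ht
  exact hsub hx hxD

/-- (1.47) in r12's typed shape for contours in `bondN` over an admissible sequence. [cite: Balaban1989LargeFieldI, (1.47) p.186] -/
theorem ineq147_walk_nbr_admissible {M : ℕ} {D : ℕ → Set (Fin d → ℤ)}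
    (hdist : ∀ n, ∀ x ∈ D (n + 1), ∀ y, Within ((side L M (n + 1) : ℤ) - 1) x y → y ∈ D n)
    (hM₁ : 0 < M₁) (hdvd : M₁ ∣ M) (hM : 0 < M) (hL : 2 ≤ L) {i j : ℕ}
    {s t : CubeSite M₁ L (fun n => (D n)ᶜ)} (p : (bondN M₁ L (fun n => (D n)ᶜ)).Walk s t) (hs : zoneC s ≤ i)
    (ht : ∃ x ∈ cube M₁ L t.1.1 t.1.2, x ∈ D (j + 1)) {δ : ℝ} (hδ : 0 ≤ δ) :
    B15.PrelimIntegrations.Ineq147 δ (p.length : ℝ) M M₁ ((j - i : ℕ) : ℝ) := by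
  have h := walk_length_ge_nbr_admissible hdist hM₁ hdvd hM hL p hs ht
  have hM₁' : (0 : ℝ) < M₁ := by exact_mod_cast hM₁
  have hcast : ((M / M₁ : ℕ) : ℝ) = (M : ℝ) / M₁ := Nat.cast_div hdvd hM₁'.ne'
  have h' : (M : ℝ) / M₁ * ((j - i : ℕ) : ℝ) ≤ (p.length : ℝ) := by
    rw [← hcast]
    exact_mod_cast h
  exact B15.PrelimIntegrations.ineq147_of_dist (by nlinarith [h', hδ])

/-- … and for the maximal sequence `maxDom`. [cite: Balaban1989LargeFieldI, (1.47) p.186; Balaban1988Convergent, (2.13) p.256] -/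
theorem walk_length_ge_nbr_maxDom {M : ℕ} (Ω : Set (Fin d → ℤ)) (hM₁ : 0 < M₁) (hdvd : M₁ ∣ M) (hM : 0 < M)
    (hL : 2 ≤ L) {i j : ℕ} {s t : CubeSite M₁ L (fun n => (maxDom L M Ω n)ᶜ)}
    (p : (bondN M₁ L (fun n => (maxDom L M Ω n)ᶜ)).Walk s t) (hs : zoneC s ≤ i)
    (ht : ∃ x ∈ cube M₁ L t.1.1 t.1.2, x ∈ maxDom L M Ω (j + 1)) : M / M₁ * (j - i) ≤ p.length :=
  walk_length_ge_nbr_admissible (admissible_maxDom L M Ω) hM₁ hdvd hM hL p hs ht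

end NeighbourScale

end Literature.MathematicalPhysics.QuantumFieldTheory.Balaban1983to89.B15Ineq147Admissible
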